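import Summits.CriticalPhenomena.PercolationContinuityZ3.Theorems.PercNearOneGluingNoHeavyLowerTailKnQuestion8CoefficientwiseQmixRootEdgeClasses
import HarnessLib

/-!
# The two-point exclusion at a point with a ROOT EDGE — the wall sum at a wall vertex that is a LEAF at the extra source is nonnegative — prim-lf-2 gen 51 (part 2c)

Support file (`--supports stmt-CriticalPhenomena-4575`, closed), prover `prim-lf-2` (gen 51).  No definitions, no named facts, no sorries; standard axioms.
Memo `prim-lf-2/CW-ROOTEDGE-gen51.md` §3; part 1 is `…CoefficientwiseQmixRootEdgeClasses.lean`, the sibling is `…QmixRootEdgeSmallWall.lean`.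

Setting as in part 1: `D` = ALL edges at the point `u`, a class `R ⊆ D` whose red edges go to `x` (`eₓ`) and `q` (`e_q`) and whose blue edges `D ∖ R` go to `p`; `a(r) = K(r⁺ ∪ R)`,
`b(r) = K((rᶜ)⁺ ∪ (D ∖ R))` on the sub-cube off `D`, and the ROOT-DOM wall sum `WC_R(p)[g] = Σ_r [p ∉ a r][p ∉ b r]·(g(a r) − g(b r))`.
* `wallClass_nonneg_of_leafWall` — **if the only edge at `p` off `D` is `e₁ = pq` (the wall vertex is a leaf hanging at the extra red source), then `WC_R(p)[g] ≥ 0` for EVERY monotone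
  `g`**: resolving `e₁`, the red class vanishes (`p ∈ a` via `q`), and in the blue class `p ∉ b ⟺ q ∉ Kb`, where `b = Kb` exactly; what is left is `Σ_{r′} [q ∉ Kb]·(g(Ka) − g(Kb)) ≥ 0`
  ('Harris twice': antithetic kernel + `Kb(r′) ⊆ Ka(r′ᶜ)` termwise).
Used by part 3 (`…QmixRootEdgeMain.lean`) for the 6-vertex residue of CONJECTURE NO-CORE for the points (12 of the residual `(G, y)` have a wall vertex of this kind; prim-lf-2 census/gen51).
[cite: KozmaNitzan2024, Questions 8–9 (§5.5 p. 36) (context: the Question-8 pocket covariance programme)]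
-/

namespace Summit.CriticalPhenomena.PercolationContinuityZ3.Theorems

open Finset Literature.Probability.Percolation

namespace Coefficientwise

variable {ι V : Type*} [Fintype ι] [DecidableEq ι] (ends : ι → Sym2 V) (x : V)

section leafWall

variable {u p q : V} (D R : Finset ι)

open Classical in
/-- **The ROOT-DOM wall sum at a wall vertex that is a leaf at the extra source is nonnegative, for every monotone `g`.**  Let `D` be ALL edges at `u`, `R ⊆ D` with `eₓ ∈ R` (`{u,x}`),
`e_q ∈ R` (`{u,q}`), every edge of `R` with ends `{u,x}` or `{u,q}`, every edge of `D ∖ R` with ends `{u,p}`; let `e₁` have ends `{p,q}` and suppose every edge off `D` containing `p` is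
`e₁` (`x, p, q ≠ u`; `x, q ≠ p`).  Then `0 ≤ Σ_r [p ∉ a r][p ∉ b r]·(g(a r) − g(b r))`.  [cite: KozmaNitzan2024, Questions 8–9 (§5.5 p. 36) (context)] -/
theorem wallClass_nonneg_of_leafWall (hdeg : ∀ i, u ∈ ends i → i ∈ D) (hD : ∀ i ∈ D, u ∈ ends i)
    {eₓ : ι} (heₓ : ends eₓ = s(u, x)) (heₓR : eₓ ∈ R) (hxu : x ≠ u)
    {e_q : ι} (he_q : ends e_q = s(u, q)) (he_qR : e_q ∈ R) (hqu : q ≠ u)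
    (hRends : ∀ i ∈ R, ends i = s(u, x) ∨ ends i = s(u, q))
    (hP : ∀ i ∈ D \ R, ends i = s(u, p)) (hpu : p ≠ u)
    {e₁ : ι} (he₁ : ends e₁ = s(p, q)) (hleaf : ∀ i, i ∉ D → p ∈ ends i → i = e₁)
    (hxp : x ≠ p) (hqp : q ≠ p) (g : Set V → ℝ) (hg : Monotone g) :
    0 ≤ ∑ r : Finset {j : ι // j ∉ D},
      (if (p ∉ openCluster (ends '' (↑(r.map (Function.Embedding.subtype _) ∪ R) : Set ι)) x ∧
            p ∉ openCluster (ends '' (↑(rᶜ.map (Function.Embedding.subtype _) ∪ (D \ R)) : Set ι)) x) then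
        (g (openCluster (ends '' (↑(r.map (Function.Embedding.subtype _) ∪ R) : Set ι)) x) -
          g (openCluster (ends '' (↑(rᶜ.map (Function.Embedding.subtype _) ∪ (D \ R)) : Set ι)) x))
      else 0) := by
  set emb := Function.Embedding.subtype (fun j : ι => j ∉ D) with hemb
  set K : Finset ι → Set V := fun S => openCluster (ends '' (↑S : Set ι)) x with hK
  have he₁D : e₁ ∉ D := by
    intro h; have := hD e₁ h; rw [he₁, Sym2.mem_iff] at this
    rcases this with h1 | h1
    · exact hpu h1.symm
    · exact hqu h1.symm
  set e₁' : {j : ι // j ∉ D} := ⟨e₁, he₁D⟩ with he₁'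
  set D' : Finset {j : ι // j ∉ D} := {e₁'} with hD'
  set emb' := Function.Embedding.subtype (fun j' : {j : ι // j ∉ D} => j' ∉ D') with hemb'
  set Φ : Finset {j : ι // j ∉ D} → Finset {j : ι // j ∉ D} → ℝ := fun s t =>
    if (p ∉ K (s.map emb ∪ R) ∧ p ∉ K (t.map emb ∪ (D \ R))) then (g (K (s.map emb ∪ R)) - g (K (t.map emb ∪ (D \ R)))) else 0 with hΦ
  change 0 ≤ ∑ r : Finset {j : ι // j ∉ D}, Φ r rᶜ
  rw [sum_cube_eq_sum_powerset_subcube D' Φ]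
  set Ta : Finset {j' : {j : ι // j ∉ D} // j' ∉ D'} → Finset ι := fun r' => (r'.map emb').map emb ∪ R with hTa
  set Tb : Finset {j' : {j : ι // j ∉ D} // j' ∉ D'} → Finset ι := fun r' => (r'ᶜ.map emb').map emb with hTb
  have mem_mm : ∀ (t : Finset {j' : {j : ι // j ∉ D} // j' ∉ D'}) (i : ι),
      i ∈ (t.map emb').map emb ↔ ∃ h : i ∉ D, ∃ h' : (⟨i, h⟩ : {j : ι // j ∉ D}) ∉ D', (⟨⟨i, h⟩, h'⟩ : {j' : {j : ι // j ∉ D} // j' ∉ D'}) ∈ t := by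
    intro t i
    rw [mem_map_subtype_iff]
    constructor
    · rintro ⟨h, hm⟩
      obtain ⟨h', hm'⟩ := (mem_map_subtype_iff (fun j' : {j : ι // j ∉ D} => j' ∉ D') t ⟨i, h⟩).mp hm
      exact ⟨h, h', hm'⟩
    · rintro ⟨h, h', hm⟩
      exact ⟨h, (mem_map_subtype_iff (fun j' : {j : ι // j ∉ D} => j' ∉ D') t ⟨i, h⟩).mpr ⟨h', hm⟩⟩
  have hR_p : ∀ i ∈ R, p ∉ ends i := by
    intro i hi hpi
    rcases hRends i hi with h | h <;> rw [h, Sym2.mem_iff] at hpi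
    · rcases hpi with h1 | h1; exact hpu h1; exact hxp h1.symm
    · rcases hpi with h1 | h1; exact hpu h1; exact hqp h1.symm
  have hmm_p : ∀ (t : Finset {j' : {j : ι // j ∉ D} // j' ∉ D'}), ∀ i ∈ (t.map emb').map emb, p ∉ ends i := by
    intro t i hi hpi
    obtain ⟨h, h', _⟩ := (mem_mm t i).mp hi
    apply h'
    rw [hD', Finset.mem_singleton]
    exact Subtype.ext (hleaf i h hpi)
  have hmm_u : ∀ (t : Finset {j' : {j : ι // j ∉ D} // j' ∉ D'}), ∀ i ∈ (t.map emb').map emb, u ∉ ends i := by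
    intro t i hi hui
    obtain ⟨h, _, _⟩ := (mem_mm t i).mp hi
    exact h (hdeg i hui)
  have hTa_p : ∀ r', ∀ i ∈ Ta r', p ∉ ends i := by
    intro r' i hi
    rcases Finset.mem_union.mp hi with hi | hi
    · exact hmm_p r' i hi
    · exact hR_p i hi
  have hTb_p : ∀ r', ∀ i ∈ Tb r', p ∉ ends i := fun r' => hmm_p r'ᶜ
  have hTb_u : ∀ r', ∀ i ∈ Tb r', u ∉ ends i := fun r' => hmm_u r'ᶜ
  have he₁u : u ∉ ends e₁ := by rw [he₁, Sym2.mem_iff]; rintro (h | h); exact hpu h.symm; exact hqu h.symm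
  -- (1) e₁ red ⇒ p red-reached
  have hp_red : ∀ S : Finset ι, R ⊆ S → e₁ ∈ S → p ∈ K S := by
    intro S hRS he₁S
    have hu : u ∈ K S := (mem_openCluster_iff_of_edge ends x S heₓ hxu (hRS heₓR)).mpr (mem_openCluster_self _ x)
    have hq : q ∈ K S := (mem_openCluster_iff_of_edge ends x S he_q hqu (hRS he_qR)).mp hu
    exact (mem_openCluster_iff_of_edge ends x S he₁ hqp he₁S).mpr hq
  -- (2) stripping the pendant star at u
  have strip_u : ∀ (T : Finset ι), (∀ i ∈ T, u ∉ ends i) → ∀ v, v ≠ u → (v ∈ K (T ∪ (D \ R)) ↔ v ∈ K T) := by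
    intro T hT v hvu
    constructor
    · intro hv
      rcases openCluster_union_pendantStar_subset ends x T (D \ R) hT hP hxu v hv with h | h
      · exact absurd h hvu
      · exact h
    · intro hv; exact openCluster_image_mono ends Finset.subset_union_left x hv
  set Ka : Finset {j' : {j : ι // j ∉ D} // j' ∉ D'} → Set V := fun r' => K (Ta r') with hKa
  set Kb : Finset {j' : {j : ι // j ∉ D} // j' ∉ D'} → Set V := fun r' => K (Tb r') with hKb
  -- class {e₁'}: zero
  have class_e₁ : ∑ r' : Finset {j' : {j : ι // j ∉ D} // j' ∉ D'}, Φ (r'.map emb' ∪ {e₁'}) (r'ᶜ.map emb' ∪ (D' \ {e₁'})) = 0 := by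
    refine Finset.sum_eq_zero fun r' _ => ?_
    have hmem : e₁ ∈ (r'.map emb' ∪ {e₁'}).map emb ∪ R :=
      Finset.mem_union_left _ (Finset.mem_map.mpr ⟨e₁', Finset.mem_union_right _ (Finset.mem_singleton_self _), rfl⟩)
    have hp : p ∈ K ((r'.map emb' ∪ {e₁'}).map emb ∪ R) := hp_red _ Finset.subset_union_right hmem
    simp only [hΦ]
    rw [if_neg (fun h => h.1 hp)]
  -- class ∅
  have hred₀ : ∀ r' : Finset {j' : {j : ι // j ∉ D} // j' ∉ D'}, (r'.map emb' ∪ ∅).map emb ∪ R = Ta r' := by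
    intro r'; rw [Finset.union_empty]
  have hD'map : D'.map emb = {e₁} := by rw [hD', Finset.map_singleton]; rfl
  have hblue₀ : ∀ r' : Finset {j' : {j : ι // j ∉ D} // j' ∉ D'}, (r'ᶜ.map emb' ∪ (D' \ ∅)).map emb ∪ (D \ R) = insert e₁ (Tb r') ∪ (D \ R) := by
    intro r'
    rw [Finset.sdiff_empty, Finset.map_union, hD'map]
    ext a
    simp only [Finset.mem_union, Finset.mem_singleton, Finset.mem_insert]
    tauto
  have class_empty : ∀ r' : Finset {j' : {j : ι // j ∉ D} // j' ∉ D'},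
      Φ (r'.map emb' ∪ ∅) (r'ᶜ.map emb' ∪ (D' \ ∅)) = (if q ∉ Kb r' then (g (Ka r') - g (Kb r')) else 0) := by
    intro r'
    simp only [hΦ]
    rw [hred₀ r', hblue₀ r']
    have hpA : p ∉ K (Ta r') := not_mem_openCluster_of_no_edge ends x (Ta r') hxp (hTa_p r')
    have hT1u : ∀ i ∈ insert e₁ (Tb r'), u ∉ ends i := by
      intro i hi; rcases Finset.mem_insert.mp hi with rfl | hi; exact he₁u; exact hTb_u r' i hi
    obtain ⟨hB1, hB2, hB3⟩ := openCluster_insert_leafEdge ends x (Tb r') he₁ hqp hxp (hTb_p r')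
    have hpB : p ∈ K (insert e₁ (Tb r') ∪ (D \ R)) ↔ q ∈ Kb r' := (strip_u _ hT1u p hpu).trans hB2
    by_cases hq : q ∈ Kb r'
    · have : p ∈ K (insert e₁ (Tb r') ∪ (D \ R)) := hpB.mpr hq
      rw [if_neg (fun h => h.2 this), if_neg (fun h => h hq)]
    · have hpB' : p ∉ K (insert e₁ (Tb r') ∪ (D \ R)) := fun h => hq (hpB.mp h)
      -- on this event the blue cluster is exactly Kb r'
      have hBeq : K (insert e₁ (Tb r') ∪ (D \ R)) = Kb r' := by
        apply Set.Subset.antisymm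
        · refine openCluster_subset_of_adjClosed ends x _ (Kb r') (mem_openCluster_self _ x) ?_
          intro c hc d hcd
          rw [openGraph_image_adj] at hcd
          obtain ⟨⟨i, hi, hicd⟩, hne2⟩ := hcd
          rcases Finset.mem_union.mp hi with hi | hi
          · rcases Finset.mem_insert.mp hi with rfl | hi
            · exfalso
              have hcd' : s(c, d) = s(p, q) := by rw [← hicd, he₁]
              rcases Sym2.eq_iff.mp hcd' with ⟨hc1, _⟩ | ⟨hc1, _⟩
              · exact hB3 (hc1 ▸ hc)
              · exact hq (hc1 ▸ hc)
            · have hadj : (openGraph (ends '' (↑(Tb r') : Set ι))).Adj c d := by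
                rw [openGraph_image_adj]; exact ⟨⟨i, hi, hicd⟩, hne2⟩
              exact SimpleGraph.Reachable.trans hc hadj.reachable
          · exfalso
            have hcd' : s(c, d) = s(u, p) := by rw [← hicd, hP i hi]
            rcases Sym2.eq_iff.mp hcd' with ⟨hc1, _⟩ | ⟨hc1, _⟩
            · exact (not_mem_openCluster_of_no_edge ends x (Tb r') hxu (hTb_u r')) (hc1 ▸ hc)
            · exact hB3 (hc1 ▸ hc)
        · intro v hv
          exact openCluster_image_mono ends (Finset.subset_union_left.trans' (Finset.subset_insert e₁ (Tb r'))) x hv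
      rw [if_pos ⟨hpA, hpB'⟩, if_pos hq, hBeq]
  have hpow : ∀ R' ∈ D'.powerset,
      ∑ r' : Finset {j' : {j : ι // j ∉ D} // j' ∉ D'}, Φ (r'.map emb' ∪ R') (r'ᶜ.map emb' ∪ (D' \ R')) =
      (if R' = ∅ then ∑ r' : Finset {j' : {j : ι // j ∉ D} // j' ∉ D'}, Φ (r'.map emb' ∪ ∅) (r'ᶜ.map emb' ∪ (D' \ ∅)) else 0) := by
    intro R' hR'
    have hRD' : R' ⊆ D' := Finset.mem_powerset.mp hR'
    by_cases h1 : e₁' ∈ R'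
    · have hReq : R' = {e₁'} := by
        ext a; constructor
        · intro ha; exact hRD' ha
        · intro ha; rw [Finset.mem_singleton.mp ha]; exact h1
      subst hReq
      rw [if_neg (Finset.singleton_ne_empty _), class_e₁]
    · have hReq : R' = ∅ := by
        ext a; constructor
        · intro ha; have := hRD' ha; rw [hD', Finset.mem_singleton] at this; rw [this] at ha; exact absurd ha h1
        · intro ha; exact absurd ha (Finset.notMem_empty _)
      subst hReq
      rw [if_pos rfl]
  rw [Finset.sum_congr rfl hpow, Finset.sum_ite_eq' D'.powerset, if_pos (Finset.empty_mem_powerset D')]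
  rw [Finset.sum_congr rfl (fun r' _ => class_empty r')]
  -- Harris twice
  set A₀ : Finset {j' : {j : ι // j ∉ D} // j' ∉ D'} → Set V := fun t => K ((t.map emb').map emb ∪ R) with hA₀
  set A₁ : Finset {j' : {j : ι // j ∉ D} // j' ∉ D'} → Set V := fun t => K ((t.map emb').map emb) with hA₁
  have hmono2 : ∀ {s t : Finset {j' : {j : ι // j ∉ D} // j' ∉ D'}}, s ⊆ t → (s.map emb').map emb ⊆ (t.map emb').map emb :=
    fun hst => Finset.map_subset_map.mpr (Finset.map_subset_map.mpr hst)
  have hA₀_mono : Monotone A₀ := fun s t hst =>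
    openCluster_image_mono ends (Finset.union_subset_union (hmono2 hst) (le_refl R)) x
  have hA₁_mono : Monotone A₁ := fun s t hst => openCluster_image_mono ends (hmono2 hst) x
  have hA₁₀ : ∀ t, A₁ t ⊆ A₀ t := fun t => openCluster_image_mono ends Finset.subset_union_left x
  have hKa : ∀ r', Ka r' = A₀ r' := fun r' => rfl
  have hKb : ∀ r', Kb r' = A₁ r'ᶜ := fun r' => rfl
  simp only [hKa, hKb]
  set E : Finset {j' : {j : ι // j ∉ D} // j' ∉ D'} → ℝ := fun r' => if q ∉ A₁ r'ᶜ then (1 : ℝ) else 0 with hE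
  have hE_mono : Monotone E := by
    intro s t hst
    simp only [hE]
    by_cases hs : q ∉ A₁ sᶜ
    · have ht : q ∉ A₁ tᶜ := fun h => hs (hA₁_mono (compl_subset_compl.mpr hst) h)
      simp [hs, ht]
    · simp only [hs, if_false]; split_ifs <;> norm_num
  have hpt : ∀ r' : Finset {j' : {j : ι // j ∉ D} // j' ∉ D'},
      (if q ∉ A₁ r'ᶜ then (g (A₀ r') - g (A₁ r'ᶜ)) else 0) = E r' * (g (A₀ r') - g (A₀ r'ᶜ)) + E r' * (g (A₀ r'ᶜ) - g (A₁ r'ᶜ)) := by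
    intro r'; simp only [hE]; split_ifs <;> ring
  rw [Finset.sum_congr rfl (fun r' _ => hpt r'), Finset.sum_add_distrib]
  have h1 : 0 ≤ ∑ r', E r' * (g (A₀ r') - g (A₀ r'ᶜ)) :=
    AntitheticProduct.sum_mul_sub_compl_nonneg E (fun t => g (A₀ t)) hE_mono (fun s t hst => hg (hA₀_mono hst))
  have h2 : 0 ≤ ∑ r' : Finset {j' : {j : ι // j ∉ D} // j' ∉ D'}, E r' * (g (A₀ r'ᶜ) - g (A₁ r'ᶜ)) := by
    refine Finset.sum_nonneg fun r' _ => mul_nonneg ?_ ?_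
    · simp only [hE]; split_ifs <;> norm_num
    · have := hg (hA₁₀ r'ᶜ); linarith
  linarith

end leafWall

end Coefficientwise

end Summit.CriticalPhenomena.PercolationContinuityZ3.Theorems
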